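import Summits.ResolutionOfSingularities.ResolutionOfSingularities.Theorems.MarkedTransferCampaignW46ThreefoldsTauTwoSlice
import Literature.AlgebraicGeometry.Resolution.CurveCentreTwoParameters
import Literature.AlgebraicGeometry.Resolution.GenericPointStalkData
import Literature.AlgebraicGeometry.Resolution.AlterationsProofs
import HarnessLib

/-!
# [CoP1] Prop. 4.4 (`CossartPiltant2008_prop44`, F-71): PLUMBING for the slices relative to an open — transport of order-reducibility
# along open immersions, the end game with residual work over the open, patching relative to an open; points of a curve on a threefold

[L1 W4.5a · crux `FInjectiveMacaulayfication` (stmt-ResolutionOfSingularities-15315); D-0154 (2) RES inputs cell, seat res-inputs-p-8b (gen 2,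
«assembly»). PROVED, fact-free, definition-free; nothing of the manuscript under adjudication is used. AI-written; AI review is weaker than
expert review. Consumed by `…Prop44SliceCurve.lean` (the regular-curve slice from the point slices).]

In the W4.6 currency (`CampaignW46.OrderReducible`, `CampaignW46.IsPermissibleBlowupSeq`) the slices of [CoP1] Prop. 4.4 are stated RELATIVE
TO AN OPEN `V ⊆ X` (conclusion `OrderReducible (J|_V) m`) so that they patch (Piltant 2013, Prop. 5.1; tree `OrderReducible.of_opens_finite`,
p508549). The blowing ups are performed on the WHOLE scheme; this file supplies the bookkeeping to read results over `V`:

* `orderReducible_comap_of_range_subset` — order-reducibility over `V` transports along any open immersion landing in `V` (étale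
  functoriality, p500660);
* `orderReducible_comap_of_seq_of_comap_preimage` — END GAME WITH RESIDUAL WORK: a sequence of permissible blowing-ups `σ : Z → X` for `(J, m)`
  plus order-reducibility of the last transform over `σ⁻¹V` gives order-reducibility of `(V, J|_V, m)` (generalises W4.6's
  `OrderReducible.comap_opens_of_seq`, where nothing is left over `V`);
* `orderReducible_comap_of_finite_of_forall_nhds` — PATCHING RELATIVE TO AN OPEN `U`: finitely many closed bad points in `U`, each settled on an
  open neighbourhood inside `U`, settle `(U, J|_U, m)` (`OrderReducible.of_finite_of_forall_nhds` on the open subscheme, regular by `Scheme.IsRegular.of_isOpenImmersion`);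
* points of a curve on a scheme of dimension `≤ 3`: `exists_rsopPair_of_coheight_eq_two`, `exists_rsopPair_of_mem_curve` (every point of a regular
  curve `cl{η}`, `codim η = 2`, is cut out by a pair of regular parameters — Matsumura 14.2, tree `exists_isRsopPart_fin_two_of_specializes`),
  `isClosed_singleton_of_mem_closure_of_ne` (its non-generic points are closed points of codimension `3`),
  `finite_of_isClosed_of_forall_isClosed_singleton` (a closed set of closed points of a Noetherian scheme is finite), `enat_le_of_lt_of_le_add_one`.

`CossartPiltant2008_prop44` is NOT proved here; resolution in dimension `≥ 4` / positive characteristic is NOT proved.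

## References
* V. Cossart, O. Piltant, J. Algebra 320 (2008), proof of Prop. 4.2 (p. 8), Prop. 4.4 (proof, p. 10). [CossartPiltant2008]
* O. Piltant, RACSAM 107 (2013), Prop. 5.1 (proof, Step 2). [Piltant2013]
* E. Bierstone, D. Grigoriev, P. Milman, J. Włodarczyk (2011), Thm. 8.0.5. [BierstoneGrigorievMilmanWlodarczyk2011]
* H. Matsumura, *Commutative Ring Theory*, Thm. 14.2. [Matsumura1987]
* The Stacks Project, Tag 02IZ. [StacksProject]
-/

-- `Summit.<Summit>.<Sub>.Theorems` with `Sub = Summit` (single-conjunct summit, D-0017)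
set_option linter.dupNamespace false

noncomputable section

open CategoryTheory CategoryTheory.Limits AlgebraicGeometry TopologicalSpace IsLocalRing
open Literature.AlgebraicGeometry.Resolution Scheme.IdealSheafData

namespace Summit.ResolutionOfSingularities.ResolutionOfSingularities.Theorems

namespace CP2008Prop44

universe u

/-! ## §0 Plumbing -/

/-- **Order-reducibility over an open transports along an open immersion landing in it.** [folklore] -/
theorem orderReducible_comap_of_range_subset {X U : Scheme.{u}} [IsLocallyNoetherian X] (J : X.IdealSheafData) {m : ℕ}
    (V : X.Opens) (f : U ⟶ X) [IsOpenImmersion f] (hf : Set.range f ⊆ (V : Set X))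
    (h : CampaignW46.OrderReducible (J.comap V.ι) m) : CampaignW46.OrderReducible (J.comap f) m := by
  have hf' : Set.range f ⊆ Set.range V.ι := by rwa [Scheme.Opens.range_ι]
  let g : U ⟶ (V : Scheme.{u}) := IsOpenImmersion.lift V.ι f hf'
  have hg : g ≫ V.ι = f := IsOpenImmersion.lift_fac V.ι f hf'
  haveI : IsOpenImmersion (g ≫ V.ι) := by rw [hg]; infer_instance
  haveI : IsOpenImmersion g := IsOpenImmersion.of_comp g V.ι
  have h' := CampaignW46.OrderReducible.comap_of_etale g h
  rwa [← Scheme.IdealSheafData.comap_comp, hg] at h'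

/-- **END GAME with residual work over the open.** A sequence of permissible blowing-ups `σ : Z → X` for `(J, m)` with last
transform `J′`, together with order-reducibility of `(σ⁻¹V, J′|_{σ⁻¹V}, m)`, gives order-reducibility of `(V, J|_V, m)`: pull the
sequence back along `V ↪ X` (étale functoriality, W4.6) and continue with the given reduction, transported along the open immersion
`Z ×_X V → σ⁻¹ V`. [cite: BierstoneGrigorievMilmanWlodarczyk2011, Thm. 8.0.5] -/
theorem orderReducible_comap_of_seq_of_comap_preimage {X Z : Scheme.{u}} [IsLocallyNoetherian X] {J : X.IdealSheafData}
    {m : ℕ} {σ : Z ⟶ X} {J' : Z.IdealSheafData} (hseq : CampaignW46.IsPermissibleBlowupSeq J m σ J') (V : X.Opens)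
    (h : CampaignW46.OrderReducible (J'.comap (σ ⁻¹ᵁ V).ι) m) : CampaignW46.OrderReducible (J.comap V.ι) m := by
  obtain ⟨Z', σ', ψ, hpb, hfl, hur, hft, hseq'⟩ := hseq.exists_isPullback_of_etale V.ι
  haveI : IsLocallyNoetherian Z := hseq.isLocallyNoetherian inferInstance
  haveI : IsOpenImmersion ψ := MorphismProperty.of_isPullback (P := @IsOpenImmersion) hpb.flip inferInstance
  have hrange : Set.range ψ ⊆ ((σ ⁻¹ᵁ V : Z.Opens) : Set Z) := by
    rintro _ ⟨z, rfl⟩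
    show σ (ψ z) ∈ (V : Set X)
    rw [← Scheme.Hom.comp_apply, hpb.w, Scheme.Hom.comp_apply]
    exact (σ' z).2
  exact CampaignW46.OrderReducible.of_isPermissibleBlowupSeq hseq'
    (orderReducible_comap_of_range_subset J' (σ ⁻¹ᵁ V) ψ hrange h)

/-- **Patching relative to an open.** `X` regular locally Noetherian, `U ⊆ X` open, `S` a finite set of closed points containing
every point of `U` of order `≥ m`; if every `x ∈ S` has an open `W ∋ x`, `W ⊆ U`, with `(W, J|_W, m)` order-reducible, then
`(U, J|_U, m)` is order-reducible. (`OrderReducible.of_finite_of_forall_nhds` on the open subscheme `U`.)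
[cite: Piltant2013, Prop. 5.1 (proof, Step 2)] -/
theorem orderReducible_comap_of_finite_of_forall_nhds {X : Scheme.{u}} [IsLocallyNoetherian X] (hX : Scheme.IsRegular X)
    (J : X.IdealSheafData) {m : ℕ} (U : X.Opens) (S : Set X) (hS : S.Finite)
    (hSc : ∀ x ∈ S, IsClosed ({x} : Set X))
    (hJS : ∀ x : X, x ∈ (U : Set X) → (m : ℕ∞) ≤ idealOrder J x → x ∈ S)
    (hloc : ∀ x ∈ S, ∃ W : X.Opens, x ∈ W ∧ W ≤ U ∧ CampaignW46.OrderReducible (J.comap W.ι) m) :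
    CampaignW46.OrderReducible (J.comap U.ι) m := by
  classical
  have hU : Scheme.IsRegular (U : Scheme.{u}) := Scheme.IsRegular.of_isOpenImmersion U.ι hX
  refine CampaignW46.OrderReducible.of_finite_of_forall_nhds hU (J.comap U.ι) (U.ι ⁻¹' S)
    (hS.preimage (Set.injOn_of_injective U.ι.injective)) (fun x hx => ?_) (fun x hx => ?_) (fun x hx => ?_)
  · have : ({x} : Set (U : Scheme.{u})) = U.ι ⁻¹' {U.ι x} := by
      ext y
      simp only [Set.mem_singleton_iff, Set.mem_preimage]
      exact ⟨fun h => by rw [h], fun h => U.ι.injective h⟩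
    rw [this]
    exact (hSc _ hx).preimage U.ι.continuous
  · rw [idealOrder_comap_of_etale] at hx
    exact hJS _ x.2 hx
  · obtain ⟨W, hxW, hWU, hW⟩ := hloc _ hx
    refine ⟨U.ι ⁻¹ᵁ W, hxW, ?_⟩
    have hrange : Set.range ((U.ι ⁻¹ᵁ W).ι ≫ U.ι) ⊆ (W : Set X) := by
      rintro _ ⟨y, rfl⟩
      rw [Scheme.Hom.comp_apply]
      exact y.2
    have h := orderReducible_comap_of_range_subset J W ((U.ι ⁻¹ᵁ W).ι ≫ U.ι) hrange hW
    rwa [Scheme.IdealSheafData.comap_comp] at h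


/-! ## §1 Points of a curve on a scheme of dimension `≤ 3` -/

/-- A regular system of parameters of length `2` at a point of codimension `2` with regular local ring, as an `IsRsopPart` pair generating
the ideal of the closure of the point. [cite: Matsumura1987, Thm. 14.2] -/
theorem exists_rsopPair_of_coheight_eq_two {X : Scheme.{u}} {η : X} [IsRegularLocalRing (X.presheaf.stalk η)]
    (hcoh : Order.coheight η = 2) {Y : Closeds X} (hYη : (Y : Set X) = closure {η}) :
    ∃ c : Fin 2 → X.presheaf.stalk η, IsRsopPart c ∧ Ideal.span (Set.range c) = stalkIdeal (vanishingIdeal Y) η := by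
  have hd : (maximalIdeal (X.presheaf.stalk η)).spanFinrank = 2 := spanFinrank_maximalIdeal_stalk_eq η hcoh
  obtain ⟨c₀, hc₀⟩ := exists_regularSystemOfParameters (R := X.presheaf.stalk η)
  let c : Fin 2 → X.presheaf.stalk η := fun i => c₀ (i.cast hd.symm)
  have hrange : Set.range c = Set.range c₀ := by
    ext a
    constructor
    · rintro ⟨i, rfl⟩; exact ⟨i.cast hd.symm, rfl⟩
    · rintro ⟨i, rfl⟩; exact ⟨i.cast hd, by simp [c]⟩
  have hc : Ideal.span (Set.range c) = maximalIdeal _ := by rw [hrange, hc₀]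
  refine ⟨c, ⟨inferInstance, 0, Fin.elim0, ?_, ?_⟩, ?_⟩
  · have h := (isRegularLocalRing_iff (X.presheaf.stalk η)).mp inferInstance
    rw [hd] at h
    rw [← h]
  · rw [Set.range_eq_empty (Fin.elim0 : Fin 0 → _), Set.union_empty, hc]
  · rw [hc, stalkIdeal_vanishingIdeal_eq_maximalIdeal_of_closure_eq hYη]

/-- On a scheme all of whose points have codimension `≤ 3`: a point of the closure of a codimension-`2` point `η`, other than `η`, is a
CLOSED point (it has codimension `3`, and a further specialisation would have codimension `4`). [cite: StacksProject, Tag 02IZ] -/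
theorem isClosed_singleton_of_mem_closure_of_ne {X : Scheme.{u}} (hcoh3 : ∀ z : X, Order.coheight z ≤ 3) {η : X}
    (hcoh : Order.coheight η = 2) {y : X} (hy : y ∈ closure ({η} : Set X)) (hne : y ≠ η) :
    Order.coheight y = 3 ∧ IsClosed ({y} : Set X) := by
  have hηy : η ⤳ y := specializes_iff_mem_closure.mpr hy
  have hyη : ¬ y ⤳ η := fun h => hne ((Specializes.antisymm h hηy).eq)
  obtain ⟨-, hy3⟩ := coheight_eq_two_of_specializes hηy hyη (by rw [hcoh]; exact_mod_cast one_lt_two) (hcoh3 y)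
  refine ⟨hy3, ?_⟩
  rw [← closure_subset_iff_isClosed]
  intro z hz
  have hyz : y ⤳ z := specializes_iff_mem_closure.mpr hz
  by_contra hzy
  have hzy' : ¬ z ⤳ y := fun h => hzy ((Specializes.antisymm h hyz).eq)
  have hlt : z < y := lt_of_le_not_ge (Scheme.le_iff_specializes.mpr hyz) fun h' => hzy' (Scheme.le_iff_specializes.mp h')
  have h1 : Order.coheight y + 1 ≤ Order.coheight z := Order.coheight_add_one_le hlt
  rw [hy3] at h1
  have h2 := h1.trans (hcoh3 z)
  exact absurd h2 (by decide)

/-- **At every point of a regular curve `Y = cl{η}` (`codim η = 2`) of a regular locally Noetherian scheme of dimension `≤ 3`, the ideal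
`𝓘_{Y,y}` is generated by a pair of regular parameters** (the generic point: a regular system of parameters of `𝒪_{X,η}`; a closed point:
Matsumura 14.2, tree `exists_isRsopPart_fin_two_of_specializes`). [cite: CossartPiltant2008, proof of Prop. 4.2]
[cite: Matsumura1987, Thm. 14.2] -/
theorem exists_rsopPair_of_mem_curve {X : Scheme.{u}} [IsLocallyNoetherian X] (hX : Scheme.IsRegular X)
    (hcoh3 : ∀ z : X, Order.coheight z ≤ 3) {Y : Closeds X} (hreg : Scheme.IsRegular (vanishingIdeal Y).subscheme)
    {η : X} (hYη : (Y : Set X) = closure {η}) (hcoh : Order.coheight η = 2) {y : X} (hy : y ∈ (Y : Set X)) :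
    haveI := hX y; ∃ c : Fin 2 → X.presheaf.stalk y, IsRsopPart c ∧ Ideal.span (Set.range c) = stalkIdeal (vanishingIdeal Y) y := by
  haveI := hX y
  by_cases hne : y = η
  · subst hne
    exact exists_rsopPair_of_coheight_eq_two hcoh hYη
  · rw [hYη] at hy
    have hηy : η ⤳ y := specializes_iff_mem_closure.mpr hy
    have hyη : ¬ y ⤳ η := fun h => hne ((Specializes.antisymm h hηy).eq)
    exact exists_isRsopPart_fin_two_of_specializes hreg hYη hηy hyη (by rw [hcoh]; exact_mod_cast one_lt_two) (hcoh3 y)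

/-- **A closed subset of a Noetherian scheme all of whose points are closed points is finite** (each of its finitely many irreducible
components is the closure of its generic point, a closed point). [folklore] -/
theorem finite_of_isClosed_of_forall_isClosed_singleton {X : Scheme.{u}} [IsNoetherian X] {T : Set X} (hT : IsClosed T)
    (h : ∀ t ∈ T, IsClosed ({t} : Set X)) : T.Finite := by
  obtain ⟨S, hSf, hSc, hSi, hTS⟩ := NoetherianSpace.exists_finite_set_isClosed_irreducible hT
  rw [hTS]
  refine hSf.sUnion fun C hC => ?_
  obtain ⟨ξ, hξ⟩ := QuasiSober.sober (hSi C hC) (hSc C hC)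
  have hξC : closure ({ξ} : Set X) = C := hξ.def
  have hξT : ξ ∈ T := by
    rw [hTS]
    exact Set.mem_sUnion.mpr ⟨C, hC, hξC ▸ subset_closure rfl⟩
  rw [← hξC, (h ξ hξT).closure_eq]
  exact Set.finite_singleton ξ

/-- `a < b ≤ N + 1` in `ℕ∞` gives `a ≤ N`. [folklore] -/
theorem enat_le_of_lt_of_le_add_one {a b : ℕ∞} {N : ℕ} (h1 : a < b) (h2 : b ≤ (N : ℕ∞) + 1) : a ≤ N := by
  induction b using ENat.recTopCoe with
  | top => exact absurd h2 (by simp)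
  | coe k =>
    induction a using ENat.recTopCoe with
    | top => exact absurd h1 (by simp)
    | coe j =>
      have hjk : j < k := by exact_mod_cast h1
      have hk : k ≤ N + 1 := by exact_mod_cast h2
      exact_mod_cast (by omega : j ≤ N)

end CP2008Prop44

end Summit.ResolutionOfSingularities.ResolutionOfSingularities.Theorems

end
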